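/-
Cell b2b-lgcu-borel (gen 27).  VALUE = THEOREM (a structural law on every hypothetical witness of
the crux), NOT summit progress; the crux item `SubgroupIdentityDesigns`
(stmt-MatrixMultiplication-14079) stays open and untouched.
-/
import Mathlib
import Summits.MatrixMultiplication.MatrixMultiplication.Theorems.SubgroupIdentityDesigns.Negative.FreeModuleLaw
import Summits.MatrixMultiplication.MatrixMultiplication.Theorems.SubgroupIdentityDesigns.Negative.GradedNormalizerCount
import Summits.MatrixMultiplication.MatrixMultiplication.Theorems.SubgroupIdentityDesigns.Negative.LevelOneInvariantDim
import Summits.MatrixMultiplication.MatrixMultiplication.Theorems.SubgroupIdentityDesigns.Negative.ScalarLaw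
import Summits.MatrixMultiplication.MatrixMultiplication.Theorems.SubgroupIdentityDesigns.Negative.ScalarBlockLaw
import Summits.MatrixMultiplication.MatrixMultiplication.Theorems.SubgroupIdentityDesigns.Negative.ScalarBlockLevel
import Summits.MatrixMultiplication.MatrixMultiplication.Theorems.SubgroupIdentityDesigns.Negative.PackingBridge
import Summits.MatrixMultiplication.MatrixMultiplication.Theorems.LevelTwoBeatsCubes.Negative.GradedNeumannCount

/-!
# The scalar Neumann law (right form): the interpolation count with a kernel in `H₃`

Route `LevelGradedCohnUmans`, crux `SubgroupIdentityDesigns` (stmt-MatrixMultiplication-14079),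
negative side; report `run/shared/lean/b2b/levelgraded-cu/ORACLE-g27.md` §G27-10.  VALUE = THEOREM,
NOT summit progress; the crux item is untouched and remains open.

## The law (abstract: any finite group, any bi-invariant test space `J ≤ ℂ^G`)

Let `(H₁, H₂, H₃)` satisfy the subgroup TPP and carry an identity test `f ∈ J`
(`f(a b c) = [a b c = 1]` on `H₁ H₂ H₃`), and let `K ≤ H₃` commute with `H₂` (e.g. `K` central),
`|K| = s`.  The `K`-periodised translates `h ↦ Σ_{κ ∈ K} f(u h κ v)` are right-`K`-invariant for
EVERY `K` (`probe_mem_invRight`), and on the words of `H₁ H₂ H₃` they read off the delta of a coset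
of `K` (`word_sum_right`).  Feeding the two Neumann probe families — points `a c` indexed by
`H₁ × H₃/K`, points `a b` (`b ≠ 1`) indexed by `H₁ × (H₂ ∖ 1)` — through this periodisation, the
triangular evaluation lemma `card_add_card_le_finrank` of `GradedNeumannCount` gives

  `|H₁| · |H₃ / K| + |H₁| (|H₂| − 1) ≤ dim J^K`                                    (`law_right`),

i.e. `|H₁||H₃| + s |H₁| (|H₂| − 1) ≤ s · dim J^K` (`law_right_mul`).  At `s = 1` this is the Neumann
count `|H₁||H₃| + |H₁|(|H₂| − 1) ≤ dim J`; its second summand alone is the scalar block law of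
`ScalarBlockLaw`; the first summand is new.  The mirror forms (`K ≤ H₁`, `K ≤ H₂`) are in the
companion file `ScalarNeumannCentral`.

## In `GL_m(𝔽_p)`

For a scalar subgroup `K ≤ H₃` of order `s` of a level-`k` witness of the crux
(`x, y, z = |H₁|, |H₂|, |H₃|`, `N_k = #{rank ≤ k}`, `b = #ℙ(𝔽_p^m)`):

* every level `k`:  `x z + s x (y − 1) + 1 ≤ N_k + s`            (`levelK_right`, via the mode-orbit
  bound of `ScalarBlockLevel`);
* level one:        `x z + s x (y − 1) + s (b − 1) ≤ (p − 1) b²`  (`levelOne_right`, via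
  `LevelOneInvariantDim`).

Sorry-free; standard axioms.
-/

set_option linter.dupNamespace false

noncomputable section

open scoped BigOperators Classical
open Module (finrank)

namespace Summit.MatrixMultiplication.MatrixMultiplication.Theorems.SubgroupIdentityDesigns.Negative
namespace ScalarNeumannLaw

open Literature.Barriers.MatrixMultiplication (SubgroupTPP)
open FreeModuleLaw (invRight mem_invRight)
open Summit.MatrixMultiplication.MatrixMultiplication.Theorems.LevelTwoBeatsCubes.Negative
  (card_add_card_le_finrank)

variable {G : Type} [Group G]

/-! ## Cosets and counting helpers -/

/-- Two cosets of `K ∩ H` in `H` agree iff the quotient of their chosen representatives lies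
in `K`. -/
theorem quot_eq_iff {H K : Subgroup G} (q q₀ : H ⧸ K.subgroupOf H) :
    ((q.out : H) : G)⁻¹ * ((q₀.out : H) : G) ∈ K ↔ q = q₀ := by
  rw [← Subgroup.coe_inv, ← Subgroup.coe_mul, ← Subgroup.mem_subgroupOf, ← QuotientGroup.eq,
    QuotientGroup.out_eq', QuotientGroup.out_eq']

/-- A representative of a non-identity coset lies outside `K`. -/
theorem out_not_mem {H K : Subgroup G} {q : H ⧸ K.subgroupOf H}
    (hq : q ≠ ((1 : H) : H ⧸ K.subgroupOf H)) : ((q.out : H) : G) ∉ K := by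
  intro h
  apply hq
  rw [← QuotientGroup.out_eq' q, QuotientGroup.eq, mul_one, inv_mem_iff, Subgroup.mem_subgroupOf]
  exact h

/-- `|H| = |H / (K ∩ H)| · |K|` for `K ≤ H`. -/
theorem card_eq_quot_mul {H K : Subgroup G} (hK : K ≤ H) :
    Nat.card H = Nat.card (H ⧸ K.subgroupOf H) * Nat.card K := by
  rw [Subgroup.card_eq_card_quotient_mul_card_subgroup (K.subgroupOf H),
    Nat.card_congr (Subgroup.subgroupOfEquivOfLe hK).toEquiv]

/-- `u κ v = 1 ↔ κ = u⁻¹ v⁻¹`. -/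
theorem word_eq_one_iff (u v k : G) : u * k * v = 1 ↔ k = u⁻¹ * v⁻¹ :=
  mul_eq_one_iff_eq_inv.trans eq_inv_mul_iff_mul_eq.symm

variable [DecidableEq G] [Fintype G]

/-- `#{h ∈ H : h ≠ 1} = |H| − 1`. -/
theorem card_ne_one (H : Subgroup G) : Fintype.card {b : H // b ≠ 1} = Nat.card H - 1 := by
  rw [Fintype.card_subtype_compl, Fintype.card_subtype_eq, Nat.card_eq_fintype_card]

/-! ## Periodised probes and their read-out on words -/

/-- `Σ_{κ ∈ K} [c ∧ κ = g] = [c ∧ g ∈ K]`. -/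
theorem sum_ite_and_coe_eq (K : Subgroup G) (g : G) (c : Prop) [Decidable c] :
    (∑ k : K, if c ∧ (k : G) = g then (1 : ℂ) else 0) = if c ∧ g ∈ K then 1 else 0 := by
  by_cases hc : c
  · by_cases hg : g ∈ K
    · rw [if_pos ⟨hc, hg⟩, Finset.sum_eq_single ⟨g, hg⟩]
      · simp [hc]
      · intro k _ hk
        rw [if_neg]
        rintro ⟨-, h⟩
        exact hk (Subtype.ext h)
      · intro h
        exact absurd (Finset.mem_univ _) h
    · rw [if_neg fun h => hg h.2]
      refine Finset.sum_eq_zero fun k _ => if_neg ?_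
      rintro ⟨-, hk⟩
      exact hg (hk ▸ k.2)
  · simp [hc]

omit [DecidableEq G] in
/-- The `K`-periodised translate `h ↦ Σ_{κ ∈ K} f(s h (κ t))` of `f ∈ J` (bi-invariant `J`) lies in
`J^K`, for every subgroup `K`. -/
theorem probe_mem_invRight (J : Submodule ℂ (G → ℂ))
    (hJ : ∀ f ∈ J, ∀ s t : G, (fun g => f (s * g * t)) ∈ J) (K : Subgroup G) {f : G → ℂ}
    (hf : f ∈ J) (s t : G) :
    (fun h => ∑ k : K, f (s * h * (k * t))) ∈ invRight K J := by
  refine ⟨?_, fun k₀ hk₀ h => ?_⟩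
  · have hfun : (fun h => ∑ k : K, f (s * h * (k * t))) =
        ∑ k : K, fun h => f (s * h * (k * t)) := by
      ext h; simp [Finset.sum_apply]
    rw [hfun]
    exact Submodule.sum_mem _ fun k _ => hJ f hf _ _
  · show (∑ k : K, f (s * (h * k₀) * (k * t))) = ∑ k : K, f (s * h * (k * t))
    refine Fintype.sum_equiv (Equiv.mulLeft (⟨k₀, hk₀⟩ : K)) _ _ fun k => ?_
    simp only [Equiv.coe_mulLeft, Subgroup.coe_mul, mul_assoc]

/-- Read-out of a periodised probe on a word whose `H₃`-letter carries the period: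
`Σ_κ f(a' b' (u κ v)) = [a' = 1 ∧ b' = 1] · [u⁻¹ v⁻¹ ∈ K]` (`K ≤ H₃`, `u, v ∈ H₃`). -/
theorem word_sum_right {H₁ H₂ H₃ : Subgroup G} {f : G → ℂ} {K : Subgroup G}
    (htpp : SubgroupTPP H₁ H₂ H₃) (h1 : f 1 = 1)
    (h0 : ∀ a ∈ H₁, ∀ b ∈ H₂, ∀ c ∈ H₃, a * b * c ≠ 1 → f (a * b * c) = 0)
    (hK : K ≤ H₃) {a' b' u v : G} (ha : a' ∈ H₁) (hb : b' ∈ H₂) (hu : u ∈ H₃) (hv : v ∈ H₃) :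
    (∑ k : K, f (a' * b' * (u * k * v))) =
      if (a' = 1 ∧ b' = 1) ∧ u⁻¹ * v⁻¹ ∈ K then 1 else 0 := by
  have hterm : ∀ k : K, f (a' * b' * (u * k * v)) =
      if (a' = 1 ∧ b' = 1) ∧ (k : G) = u⁻¹ * v⁻¹ then 1 else 0 := by
    intro k
    rw [idTest_apply_eq_ite htpp h1 h0 ha hb (H₃.mul_mem (H₃.mul_mem hu (hK k.2)) hv)]
    by_cases hc : (a' = 1 ∧ b' = 1) ∧ (k : G) = u⁻¹ * v⁻¹
    · rw [if_pos hc, if_pos ⟨hc.1.1, hc.1.2, (word_eq_one_iff u v k).2 hc.2⟩]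
    · rw [if_neg hc, if_neg fun h => hc ⟨⟨h.1, h.2.1⟩, (word_eq_one_iff u v k).1 h.2.2⟩]
  simp_rw [hterm]
  exact sum_ite_and_coe_eq K _ _

/-! ## The law -/

section Law

variable (J : Submodule ℂ (G → ℂ)) (hJ : ∀ f ∈ J, ∀ s t : G, (fun g => f (s * g * t)) ∈ J)
  {H₁ H₂ H₃ : Subgroup G} (htpp : SubgroupTPP H₁ H₂ H₃)
  {f : G → ℂ} (hf : f ∈ J) (h1 : f 1 = 1)
  (h0 : ∀ a ∈ H₁, ∀ b ∈ H₂, ∀ c ∈ H₃, a * b * c ≠ 1 → f (a * b * c) = 0)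
include hJ htpp hf h1 h0

/-- **SCALAR NEUMANN LAW (right form).**  `K ≤ H₃` commuting with `H₂`:
`|H₁| · |H₃ / K| + |H₁| (|H₂| − 1) ≤ dim J^K`. -/
theorem law_right {K : Subgroup G} (hK : K ≤ H₃) (hcomm : ∀ k ∈ K, ∀ b ∈ H₂, k * b = b * k) :
    Nat.card H₁ * Nat.card (H₃ ⧸ K.subgroupOf H₃) + Nat.card H₁ * (Nat.card H₂ - 1) ≤
      finrank ℂ (invRight K J) := by
  have h := card_add_card_le_finrank (A := H₁ × (H₃ ⧸ K.subgroupOf H₃))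
    (S := H₁ × {b : H₂ // b ≠ 1}) (invRight K J)
    (fun x => (x.1 : G) * ((x.2.out : H₃) : G)) (fun y => (y.1 : G) * ((y.2 : H₂) : G)) ?_ ?_
  · rw [Fintype.card_prod, Fintype.card_prod, card_ne_one, ← Nat.card_eq_fintype_card,
      ← Nat.card_eq_fintype_card] at h
    exact h
  · -- probes `h ↦ Σ_κ f(a₀⁻¹ h κ c₀⁻¹)`, `c₀ = out q₀`: delta on the points `a c`, zero on `a b`
    rintro ⟨a₀, q₀⟩
    refine ⟨fun h => ∑ k : K, f ((a₀ : G)⁻¹ * h * (k * ((q₀.out : H₃) : G)⁻¹)),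
      probe_mem_invRight J hJ K hf _ _, ?_, ?_, ?_⟩
    · show (∑ k : K, f ((a₀ : G)⁻¹ * ((a₀ : G) * ((q₀.out : H₃) : G)) *
        (k * ((q₀.out : H₃) : G)⁻¹))) = 1
      have e : ∀ k : K, (a₀ : G)⁻¹ * ((a₀ : G) * ((q₀.out : H₃) : G)) *
          (k * ((q₀.out : H₃) : G)⁻¹) =
          (a₀ : G)⁻¹ * (a₀ : G) * 1 * (((q₀.out : H₃) : G) * k * ((q₀.out : H₃) : G)⁻¹) := by
        intro k; simp only [mul_assoc, one_mul]
      simp_rw [e]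
      rw [word_sum_right htpp h1 h0 hK (H₁.mul_mem (H₁.inv_mem a₀.2) a₀.2) H₂.one_mem
        (q₀.out).2 (H₃.inv_mem (q₀.out).2), if_pos]
      exact ⟨⟨inv_mul_cancel _, rfl⟩, by rw [inv_inv]; exact (quot_eq_iff q₀ q₀).2 rfl⟩
    · rintro ⟨a, q⟩ hne
      show (∑ k : K, f ((a₀ : G)⁻¹ * ((a : G) * ((q.out : H₃) : G)) *
        (k * ((q₀.out : H₃) : G)⁻¹))) = 0
      have e : ∀ k : K, (a₀ : G)⁻¹ * ((a : G) * ((q.out : H₃) : G)) *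
          (k * ((q₀.out : H₃) : G)⁻¹) =
          (a₀ : G)⁻¹ * (a : G) * 1 * (((q.out : H₃) : G) * k * ((q₀.out : H₃) : G)⁻¹) := by
        intro k; simp only [mul_assoc, one_mul]
      simp_rw [e]
      rw [word_sum_right htpp h1 h0 hK (H₁.mul_mem (H₁.inv_mem a₀.2) a.2) H₂.one_mem
        (q.out).2 (H₃.inv_mem (q₀.out).2), if_neg]
      rintro ⟨⟨ha, -⟩, hq⟩
      rw [inv_inv] at hq
      exact hne (Prod.ext (Subtype.ext (inv_mul_eq_one.1 ha)).symm ((quot_eq_iff q q₀).1 hq))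
    · rintro ⟨a, b⟩
      show (∑ k : K, f ((a₀ : G)⁻¹ * ((a : G) * ((b : H₂) : G)) *
        (k * ((q₀.out : H₃) : G)⁻¹))) = 0
      have e : ∀ k : K, (a₀ : G)⁻¹ * ((a : G) * ((b : H₂) : G)) * (k * ((q₀.out : H₃) : G)⁻¹) =
          (a₀ : G)⁻¹ * (a : G) * ((b : H₂) : G) * (1 * k * ((q₀.out : H₃) : G)⁻¹) := by
        intro k; simp only [mul_assoc, one_mul]
      simp_rw [e]
      rw [word_sum_right htpp h1 h0 hK (H₁.mul_mem (H₁.inv_mem a₀.2) a.2) (b : H₂).2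
        H₃.one_mem (H₃.inv_mem (q₀.out).2), if_neg]
      rintro ⟨⟨-, hb⟩, -⟩
      exact b.2 (Subtype.ext hb)
  · -- probes `h ↦ Σ_κ f(a₀⁻¹ h κ b₀⁻¹)`: delta on the points `a b` (this uses `κ b₀ = b₀ κ`)
    rintro ⟨a₀, b₀⟩
    refine ⟨fun h => ∑ k : K, f ((a₀ : G)⁻¹ * h * (k * ((b₀ : H₂) : G)⁻¹)),
      probe_mem_invRight J hJ K hf _ _, ?_, ?_⟩
    · show (∑ k : K, f ((a₀ : G)⁻¹ * ((a₀ : G) * ((b₀ : H₂) : G)) *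
        (k * ((b₀ : H₂) : G)⁻¹))) = 1
      have e : ∀ k : K, (a₀ : G)⁻¹ * ((a₀ : G) * ((b₀ : H₂) : G)) * (k * ((b₀ : H₂) : G)⁻¹) =
          (a₀ : G)⁻¹ * (a₀ : G) * (((b₀ : H₂) : G) * ((b₀ : H₂) : G)⁻¹) * (1 * k * 1) := by
        intro k
        rw [hcomm k k.2 _ (H₂.inv_mem (b₀ : H₂).2)]
        simp only [mul_assoc, one_mul, mul_one]
      simp_rw [e]
      rw [word_sum_right htpp h1 h0 hK (H₁.mul_mem (H₁.inv_mem a₀.2) a₀.2)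
        (H₂.mul_mem (b₀ : H₂).2 (H₂.inv_mem (b₀ : H₂).2)) H₃.one_mem H₃.one_mem, if_pos]
      refine ⟨⟨inv_mul_cancel _, mul_inv_cancel _⟩, ?_⟩
      rw [inv_one, mul_one]
      exact K.one_mem
    · rintro ⟨a, b⟩ hne
      show (∑ k : K, f ((a₀ : G)⁻¹ * ((a : G) * ((b : H₂) : G)) *
        (k * ((b₀ : H₂) : G)⁻¹))) = 0
      have e : ∀ k : K, (a₀ : G)⁻¹ * ((a : G) * ((b : H₂) : G)) * (k * ((b₀ : H₂) : G)⁻¹) =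
          (a₀ : G)⁻¹ * (a : G) * (((b : H₂) : G) * ((b₀ : H₂) : G)⁻¹) * (1 * k * 1) := by
        intro k
        rw [hcomm k k.2 _ (H₂.inv_mem (b₀ : H₂).2)]
        simp only [mul_assoc, one_mul, mul_one]
      simp_rw [e]
      rw [word_sum_right htpp h1 h0 hK (H₁.mul_mem (H₁.inv_mem a₀.2) a.2)
        (H₂.mul_mem (b : H₂).2 (H₂.inv_mem (b₀ : H₂).2)) H₃.one_mem H₃.one_mem, if_neg]
      rintro ⟨⟨ha, hb⟩, -⟩
      exact hne (Prod.ext (Subtype.ext (inv_mul_eq_one.1 ha)).symm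
        (Subtype.ext (Subtype.ext (mul_inv_eq_one.1 hb))))

/-- **SCALAR NEUMANN LAW (right form, cleared):** `|H₁||H₃| + |K| · |H₁| (|H₂| − 1) ≤ |K| · dim J^K`. -/
theorem law_right_mul {K : Subgroup G} (hK : K ≤ H₃) (hcomm : ∀ k ∈ K, ∀ b ∈ H₂, k * b = b * k) :
    Nat.card H₁ * Nat.card H₃ + Nat.card K * (Nat.card H₁ * (Nat.card H₂ - 1)) ≤
      Nat.card K * finrank ℂ (invRight K J) := by
  have h := Nat.mul_le_mul_left (Nat.card K) (law_right J hJ htpp hf h1 h0 hK hcomm)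
  calc Nat.card H₁ * Nat.card H₃ + Nat.card K * (Nat.card H₁ * (Nat.card H₂ - 1))
      = Nat.card K * (Nat.card H₁ * Nat.card (H₃ ⧸ K.subgroupOf H₃) +
          Nat.card H₁ * (Nat.card H₂ - 1)) := by rw [card_eq_quot_mul hK]; ring
    _ ≤ _ := h

end Law

/-! ## `GL_m(𝔽_p)`: scalar subgroups of `H₃` -/

section Linear

open scoped LinearAlgebra.Projectivization
open Summit.MatrixMultiplication.MatrixMultiplication.Theorems.LieRankDesigns.Negative (GLm Mat)
open Summit.MatrixMultiplication.MatrixMultiplication.Theorems.LevelOneGL2Designs.Negative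
  (levelSubmodule levelSubmodule_bi_inv)
open PackingBridge (exists_test)
open ScalarBlockLaw (central_of_le_range semiregular_of_le_range)
open ScalarBlockLevel (card_mul_finrank_invRight_le semiregular_modes_of_le_range)

variable {p m : ℕ} [hp : Fact p.Prime] {k : ℕ}

/-- **EVERY LEVEL `k`, right form.**  Scalar `K ≤ H₃` of order `s` in a level-`k` witness:
`x z + s x (y − 1) + 1 ≤ N_k + s`. -/
theorem levelK_right {H₁ H₂ H₃ : Subgroup (GLm p m)} (htpp : SubgroupTPP H₁ H₂ H₃)
    (hdes : ∃ c : Mat p m → ℂ, (∀ M, k < M.rank → c M = 0) ∧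
      (∑ M, c M * ZMod.stdAddChar (Matrix.trace (M * ((1 : GLm p m) : Mat p m)))) = 1 ∧
      ∀ a ∈ H₁, ∀ b ∈ H₂, ∀ g ∈ H₃, a * b * g ≠ 1 →
        (∑ M, c M * ZMod.stdAddChar (Matrix.trace (M * ((a * b * g : GLm p m) : Mat p m)))) = 0)
    {K : Subgroup (GLm p m)} (hK : K ≤ H₃) (hKZ : K ≤ (scalarHom p m).range) :
    Nat.card H₁ * Nat.card H₃ + Nat.card K * (Nat.card H₁ * (Nat.card H₂ - 1)) + 1 ≤
      Fintype.card {M : Mat p m // M.rank ≤ k} + Nat.card K := by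
  obtain ⟨f, hf, h1, h0⟩ := exists_test hdes
  have h := law_right_mul (levelSubmodule p m k) levelSubmodule_bi_inv htpp hf h1 h0 hK
    fun κ hκ b _ => central_of_le_range hKZ κ hκ b
  have hdim := card_mul_finrank_invRight_le (k := k) K (semiregular_modes_of_le_range hKZ)
  omega

/-- **LEVEL ONE, right form.**  Scalar `K ≤ H₃` of order `s` in a level-one witness (`m ≥ 1`):
`x z + s x (y − 1) + s (b − 1) ≤ (p − 1) b²`, `b = #ℙ(𝔽_p^m)`. -/
theorem levelOne_right (hm : 1 ≤ m) {H₁ H₂ H₃ : Subgroup (GLm p m)}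
    (htpp : SubgroupTPP H₁ H₂ H₃)
    (hdes : ∃ c : Mat p m → ℂ, (∀ M, 1 < M.rank → c M = 0) ∧
      (∑ M, c M * ZMod.stdAddChar (Matrix.trace (M * ((1 : GLm p m) : Mat p m)))) = 1 ∧
      ∀ a ∈ H₁, ∀ b ∈ H₂, ∀ g ∈ H₃, a * b * g ≠ 1 →
        (∑ M, c M * ZMod.stdAddChar (Matrix.trace (M * ((a * b * g : GLm p m) : Mat p m)))) = 0)
    {K : Subgroup (GLm p m)} (hK : K ≤ H₃) (hKZ : K ≤ (scalarHom p m).range) :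
    Nat.card H₁ * Nat.card H₃ + Nat.card K * (Nat.card H₁ * (Nat.card H₂ - 1)) +
        Nat.card K * (Nat.card (ℙ (ZMod p) (Fin m → ZMod p)) - 1) ≤
      (p - 1) * Nat.card (ℙ (ZMod p) (Fin m → ZMod p)) ^ 2 := by
  obtain ⟨f, hf, h1, h0⟩ := exists_test hdes
  have h := law_right_mul (levelSubmodule p m 1) levelSubmodule_bi_inv htpp hf h1 h0 hK
    fun κ hκ b _ => central_of_le_range hKZ κ hκ b
  have hdim := LevelOneInvariantDim.card_mul_finrank_le_of_semiregular hm K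
    (semiregular_of_le_range hKZ)
  exact le_trans (Nat.add_le_add_right h _) hdim

end Linear

end ScalarNeumannLaw
end Summit.MatrixMultiplication.MatrixMultiplication.Theorems.SubgroupIdentityDesigns.Negative

end
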